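import Summits.NavierStokesRegularity.FluidComputer.PalasekTowerGermHostRate
import Summits.NavierStokesRegularity.FluidComputer.PalasekTowerGermHostPushed

/-!
# The germ host, XXXI: STRICT FROM WEAK — any flat, even, centred weak-slot carrier plus the far pusher fills the
# strict slot with the numeric rate `Y₀³/200000`

Cell `ns-blowup`, seat `ns-blowup-ecbridge-3` (g5); GROUP C «BRIDGE SUPPORT» of the route
`PalasekTowerBreakdown` (crux `EpisodeBaseG`, item stmt-NavierStokesRegularity-19179, R2; line `slot` v5). The generic
form of `PalasekTowerGermHostStrictTiny.lean` §1–§2 (g3) and `PalasekTowerGermHostStrictLarge.lean` §2 (g5): the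
carrier is ANY weak-slot filler `LevelZeroDataWeak U₁ ρ₁` (ecbridge-4's slot: readouts + weak anchor) that is even
about `0`, flat (`ΔU₁(0) = 0`), centred (`U₁(0) = Y₀e₃`), has its speed maximum ONLY at `0`, and is supported in
`B̄(0, ρ₁)` with `ρ₁ + 1/256 < 15/4` (so the far pusher's support `‖x‖ ≥ 15/4` misses the carrier, its strain point and
its core loop). LABEL: E–C typing (KERNEL, proofs only). WHAT THIS IS NOT: not Navier–Stokes evidence — level-`0`
bookkeeping of PRESCRIBED composite profiles at one instant; nothing about any flow after `τ₀`, `FirstEpisodeD`,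
`RungG 1` or blow-up.

* **`LevelZeroDataWeak.add_farPusher`**: under the hypotheses above, `LevelZeroData (U₁ + farPusher) 7`, and
  **`LevelZeroDataWeak.anchor_add_farPusher_ge`**: `‖(U₁ + W) x‖ = Y₀ → Y₀³/200000 ≤ ⟪(U₁ + W) x, accel 1 (U₁ + W) x⟫`
  (`rate_add_farPusher_ge`); host preparation and the crux reduction follow by the slot API. Design seats: bring a flat
  even carrier with the level-`0` readouts — the pusher supplies the strict test with a NUMBER.

References: S. Palasek, arXiv:2605.13827 §3.3 [cite: Palasek2026ElementaryModel, §3.3]; A. J. Majda, A. L. Bertozzi,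
*Vorticity and Incompressible Flow* (CUP 2002), §1.8 Prop. 1.16 [cite: MajdaBertozziCUP2002, §1.8 Prop. 1.16].
-/

noncomputable section

namespace Summit.NavierStokesRegularity.FluidComputer.PalasekTowerClayBridge.Germ

open Set Function Filter Topology InnerProductSpace Metric MeasureTheory Real
open scoped Topology ContDiff RealInnerProductSpace Laplacian

open Literature.Analysis.FluidPDE TinyBlob

namespace LevelZeroDataWeak

variable {U₁ : EuclideanSpace ℝ (Fin 3) → EuclideanSpace ℝ (Fin 3)} {ρ₁ : ℝ}
  (h₁ : LevelZeroDataWeak U₁ ρ₁) (hρ₁ : ρ₁ + 1 / 256 < 15 / 4) (he : IsEvenAbout 0 U₁)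
  (hflat : (Δ U₁) 0 = 0) (h0 : U₁ 0 = TowerRates.wide.Y 0 • e₃)
  (hargmax : ∀ x, ‖U₁ x‖ = TowerRates.wide.Y 0 → x = 0)
include h₁ hρ₁ he hflat h0 hargmax

omit hρ₁ he hflat h0 hargmax in
/-- Off `B̄(0, ρ₁)` the carrier vanishes. [folklore] -/
theorem eq_zero_of_lt {x : EuclideanSpace ℝ (Fin 3)} (hx : ρ₁ < ‖x‖) : U₁ x = 0 :=
  image_eq_zero_of_notMem_tsupport fun h => by
    have := h₁.support h
    rw [mem_closedBall, dist_zero_right] at this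
    linarith

omit h₁ hρ₁ he hflat h0 hargmax in
/-- Near the origin (`‖x‖ < 15/4`) the composite is the carrier. [folklore] -/
theorem add_farPusher_of_norm_lt {x : EuclideanSpace ℝ (Fin 3)} (hx : ‖x‖ < 15 / 4) :
    (U₁ + farPusher) x = U₁ x := by
  rw [Pi.add_apply, farPusher_eq_zero_of_norm_lt hx, add_zero]

omit hρ₁ he hflat h0 hargmax in
/-- Beyond the carrier (`‖x‖ > ρ₁`) the composite is the pusher. [folklore] -/
theorem add_farPusher_of_lt {x : EuclideanSpace ℝ (Fin 3)} (hx : ρ₁ < ‖x‖) : (U₁ + farPusher) x = farPusher x := by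
  rw [Pi.add_apply, h₁.eq_zero_of_lt hx, zero_add]

omit he hflat h0 hargmax in
/-- **Speed ceiling** `‖U‖ ≤ Y₀`. [folklore] -/
theorem norm_add_farPusher_le (x : EuclideanSpace ℝ (Fin 3)) : ‖(U₁ + farPusher) x‖ ≤ TowerRates.wide.Y 0 := by
  by_cases hx : ‖x‖ < 15 / 4
  · rw [add_farPusher_of_norm_lt hx]; exact h₁.ceiling x
  · push Not at hx
    rw [h₁.add_farPusher_of_lt (by linarith)]
    exact (norm_farPusher_lt x).le

omit he hflat h0 in
/-- **The argmax is the origin.** [folklore] -/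
theorem eq_zero_of_norm_add_farPusher_eq {x : EuclideanSpace ℝ (Fin 3)}
    (hx : ‖(U₁ + farPusher) x‖ = TowerRates.wide.Y 0) : x = 0 := by
  by_cases hn : ‖x‖ < 15 / 4
  · rw [add_farPusher_of_norm_lt hn] at hx; exact hargmax x hx
  · push Not at hn
    rw [h₁.add_farPusher_of_lt (by linarith)] at hx
    exact absurd hx (norm_farPusher_lt x).ne

omit hargmax in
/-- **THE NUMERIC ANCHOR VALUE AT THE ORIGIN**, every `ν` (`rate_add_farPusher_ge`). [cite: MajdaBertozziCUP2002, §1.8 Prop. 1.16] -/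
theorem rate_add_farPusher_ge' (ν : ℝ) :
    TowerRates.wide.Y 0 ^ 3 / 200000 ≤ ⟪(U₁ + farPusher) 0, accel ν (U₁ + farPusher) 0⟫ :=
  rate_add_farPusher_ge h₁.smooth h₁.support (by linarith) h₁.divFree he hflat h0 ν

/-- **The anchor test with the NUMERIC rate on the argmax.** [cite: Palasek2026ElementaryModel, §3.3] -/
theorem anchor_add_farPusher_ge (x : EuclideanSpace ℝ (Fin 3)) (hx : ‖(U₁ + farPusher) x‖ = TowerRates.wide.Y 0) :
    TowerRates.wide.Y 0 ^ 3 / 200000 ≤ ⟪(U₁ + farPusher) x, accel 1 (U₁ + farPusher) x⟫ := by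
  obtain rfl := h₁.eq_zero_of_norm_add_farPusher_eq hρ₁ hargmax hx
  exact h₁.rate_add_farPusher_ge' hρ₁ he hflat h0 1

omit he hflat h0 hargmax in
/-- `tsupport U ⊆ B̄(0, 7)`. [folklore] -/
theorem tsupport_add_farPusher_subset :
    tsupport (U₁ + farPusher) ⊆ closedBall (0 : EuclideanSpace ℝ (Fin 3)) 7 := by
  refine closure_minimal (fun x hx => ?_) isClosed_closedBall
  rw [mem_closedBall, dist_zero_right]
  by_contra hfar
  push Not at hfar
  refine hx ?_
  rw [h₁.add_farPusher_of_lt (by linarith)]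
  refine farPusher_eq_zero fun hmem => ?_
  have hg := (geometry_of_mem_tsupport hmem).1
  have : ‖x‖ ≤ ‖x - pusherCenter‖ + ‖pusherCenter‖ := norm_le_norm_sub_add x pusherCenter
  rw [norm_pusherCenter] at this
  linarith

omit hρ₁ he hflat h0 hargmax in
/-- `U` is divergence free. [folklore] -/
theorem isDivFree_add_farPusher : VectorCalculus.IsDivFree (U₁ + farPusher) := by
  intro x
  have hd1 := h₁.divFree x
  have hd2 := isDivFree_farPusher x
  simp only [VectorCalculus.divergence] at hd1 hd2 ⊢
  rw [fderiv_add (h₁.smooth.differentiable (by simp) x) (contDiff_farPusher.differentiable (by simp) x)]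
  push_cast
  rw [map_add, hd1, hd2, add_zero]

omit h₁ hρ₁ he hflat h0 hargmax in
/-- Near the origin the Jacobian of `U` is the carrier's. [folklore] -/
theorem fderiv_add_farPusher_of_norm_lt {x : EuclideanSpace ℝ (Fin 3)} (hx : ‖x‖ < 15 / 4) :
    fderiv ℝ (U₁ + farPusher) x = fderiv ℝ U₁ x := by
  have hev : (U₁ + farPusher) =ᶠ[𝓝 x] U₁ := by
    have hopen : IsOpen {y : EuclideanSpace ℝ (Fin 3) | ‖y‖ < 15 / 4} := isOpen_lt continuous_norm continuous_const
    filter_upwards [hopen.mem_nhds hx] with y hy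
    exact add_farPusher_of_norm_lt hy
  exact hev.fderiv_eq

omit he hflat h0 hargmax in
/-- **The strain floor** is the carrier's. [folklore] -/
theorem strain_add_farPusher :
    ∃ x : EuclideanSpace ℝ (Fin 3), ‖x‖ ≤ 7 ∧ TowerRates.wide.A 0 ≤ ‖fderiv ℝ (U₁ + farPusher) x‖ := by
  obtain ⟨x, hx, hA⟩ := h₁.strain
  refine ⟨x, by linarith, ?_⟩
  rw [fderiv_add_farPusher_of_norm_lt (by linarith)]
  exact hA

omit he hflat h0 hargmax in
/-- **The core loop** is the carrier's (the pusher vanishes along it). [folklore] -/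
theorem core_add_farPusher :
    ∃ (x : EuclideanSpace ℝ (Fin 3)) (γ : ℝ → EuclideanSpace ℝ (Fin 3)),
      ‖x‖ ≤ 7 ∧ ContDiff ℝ 1 γ ∧ γ 0 = γ 1 ∧
        (∀ s ∈ Icc (0 : ℝ) 1, γ s ∈ closedBall x (1 / TowerRates.wide.N 0)) ∧
        (∀ s ∈ Icc (0 : ℝ) 1, ‖deriv γ s‖ ≤ 8 * Real.pi / TowerRates.wide.N 0) ∧
        TowerRates.wide.N 0 ^ (TowerRates.wide.β - 2) ≤ circulation (U₁ + farPusher) γ := by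
  obtain ⟨x, γ, hx, hγ, h01, hball, hvel, hcirc⟩ := h₁.core
  refine ⟨x, γ, by linarith, hγ, h01, hball, hvel, ?_⟩
  have hc : circulation (U₁ + farPusher) γ = circulation U₁ γ := by
    unfold circulation
    refine intervalIntegral.integral_congr fun s hs => ?_
    rw [uIcc_of_le zero_le_one] at hs
    have hs' : ‖γ s‖ < 15 / 4 := by
      have hbs := hball s hs
      rw [mem_closedBall, dist_eq_norm, Host.wide_N_zero] at hbs
      have : ‖γ s‖ ≤ ‖γ s - x‖ + ‖x‖ := norm_le_norm_sub_add (γ s) x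
      linarith
    simp only [add_farPusher_of_norm_lt hs']
  rw [hc]
  exact hcirc

/-- **STRICT FROM WEAK**: `LevelZeroData (U₁ + farPusher) 7` for every weak-slot carrier that is even about `0`, flat,
centred, with its speed maximum only at `0` and `ρ₁ + 1/256 < 15/4`. [cite: Palasek2026ElementaryModel, §3.3] -/
theorem add_farPusher : LevelZeroData (U₁ + farPusher) 7 where
  smooth := h₁.smooth.add contDiff_farPusher
  support := h₁.tsupport_add_farPusher_subset hρ₁
  divFree := h₁.isDivFree_add_farPusher
  ceiling := h₁.norm_add_farPusher_le hρ₁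
  floor := ⟨0, by simp, by rw [add_farPusher_of_norm_lt (by simp), h0, norm_Y_smul_e₃]⟩
  strain := h₁.strain_add_farPusher hρ₁
  core := h₁.core_add_farPusher hρ₁
  anchor x hx := lt_of_lt_of_le (by have := Host.wide_Y_zero_pos; positivity)
    (h₁.anchor_add_farPusher_ge hρ₁ he hflat h0 hargmax x hx)

/-- **Host preparation** for these composites, every push `c₄ ∈ (0, 1]`. [cite: Palasek2026ElementaryModel, §3.3] -/
theorem hostPreparationD_add_farPusher {c₄ : ℝ} (hc₄ : 0 < c₄) (hc₄' : c₄ ≤ 1) :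
    HostPreparationD (HostClass.exact ((h₁.add_farPusher hρ₁ he hflat h0 hargmax).schedule c₄ hc₄ hc₄')) :=
  (h₁.add_farPusher hρ₁ he hflat h0 hargmax).hostPreparationD_exact hc₄ hc₄'

/-- **… and the crux for them is their episode.** [cite: Palasek2026ElementaryModel, §4] -/
theorem episodeBaseG_of_firstEpisodeD_add_farPusher {c₄ : ℝ} (hc₄ : 0 < c₄) (hc₄' : c₄ ≤ 1)
    (hF : FirstEpisodeD (HostClass.exact ((h₁.add_farPusher hρ₁ he hflat h0 hargmax).schedule c₄ hc₄ hc₄'))) :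
    EpisodeBaseG :=
  (h₁.add_farPusher hρ₁ he hflat h0 hargmax).episodeBaseG_of_firstEpisodeD hc₄ hc₄' hF

end LevelZeroDataWeak

end Summit.NavierStokesRegularity.FluidComputer.PalasekTowerClayBridge.Germ

end
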